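import Mathlib.Analysis.Complex.UpperHalfPlane.MoebiusAction
import Mathlib.Topology.Compactification.OnePoint.ProjectiveLine
import Mathlib.Analysis.SpecialFunctions.Trigonometric.Arctan
import Mathlib.Analysis.Complex.Periodic
import HarnessLib

/-!
# [IUTchI] §6, Remark 6.12.3: the `𝔽_l^{⋊±}`- and `𝔽_l^⋇`-symmetries vs. the upper half-plane

Mochizuki, *Inter-universal Teichmüller theory I: construction of Hodge theaters*, §6 "Additive
Combinatorial Teichmüller Theory", Remark 6.12.3 (i)–(iii) with Fig. 6.4, kurims manuscript (May 2020)
pp. 175–178 [claim: Mochizuki2012, status: disputed] — abc-iut cell, layer L5, row W2-L5-03a (the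
expository tail of §6; Remark 6.12.4 is the sibling file `PMTheatersLabelRemarks.lean`; Remarks
6.12.5–6.12.6 are abc-iut-L5-t7's; Remarks 6.12.1–6.12.2 and Def. 6.13 are abc-iut-L5-t4's).

Remark 6.12.3 is EXPOSITORY: it compares the additive `𝔽_l^{⋊±}`-symmetry of `Θ^{±ell}`-Hodge theaters
(§6, Prop. 6.8 (i)) and the multiplicative `𝔽_l^⋇`-symmetry of `ΘNF`-Hodge theaters (§4, Prop. 4.9 (i))
with two families of symmetries of the upper half-plane `ℍ`. Its sub-items are recorded as follows.

* **(i)** p. 175 — NOTED (prose, no checkable assertion): a `ΘNF`-Hodge theater as "a sort of total space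
  of a local system of `𝔽_l^⋇`-torsors over a 'base space' that represents a sort of 'homotopy' between a
  number field and a Tate curve", a `Θ^{±ell}`-Hodge theater likewise with `𝔽_l^{⋊±}`-torsors; these
  torsors arise from the `l`-torsion points, hence are "discrete approximations" of [the geometric portion
  of] the elliptic curve (cf. [HASurI] §1.3.4), and, via the tempered fundamental groups at `v ∈ V^bad`,
  "finite approximations of the copy of `ℤ`" occurring as the Galois group of a tempered covering of the
  Tate curve (cf. [EtTh] Rmk. 2.16.2); with `Θ^{±ell}NF`-Hodge theaters one works with "both the additive
  and the multiplicative structures of this copy of `ℤ`", each occurring "in an independent fashion",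
  "extracted" from their ring-theoretic entanglement (cf. [AbsTopIII] Rmk. 5.6.1). The objects named are
  typed elsewhere: `FlStar` (`Labels.lean`), `FlPM`, `FlPMTorsor` (`LabelsPlusMinus*.lean`), the Hodge
  theaters of Def. 5.5 (iii), 6.11 (iii), 6.13 (i) (abc-iut-L5-t4; TODO-merge:abc-iut-L5-t4).
* **(ii)** pp. 175–176 — NOTED (prose analogy): relative to `p`-adic Teichmüller theory ([AbsTopIII] §I5)
  the "base space" representing a number field corresponds to a hyperbolic curve in positive
  characteristic, and the "local system-theoretic" copy of `ℤ` of (i) to a nilpotent ordinary indigenous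
  bundle over it.
* **(iii)** pp. 176–177, Fig. 6.4 p. 178 — TYPED AND PROVED below (namespace `Rmk6123`) over Mathlib's
  `GL₂(ℝ)`-actions on `ℍ` (`UpperHalfPlane.glAction`: Möbius maps, composed with complex conjugation for
  negative determinant) and on the boundary `∂ℍ = ℝ ∪ {∞} = P¹(ℝ)` (`OnePoint.instGLAction`): "the two
  real dimensions `z ↦ z + a, z ↦ −z̄ + a`; `z ↦ (z·cos t − sin t)/(z·sin t + cos t),
  z ↦ (z̄·cos t + sin t)/(z̄·sin t − cos t)` — where `a, t ∈ ℝ` — of transformations of the upper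
  half-plane" are the elements `addSymm a`, `addSymmRefl a` ("additive") and `mulSymm t`, `mulSymmRefl t`
  ("toral", "multiplicative") of `GL₂(ℝ)` (`coe_addSymm_smul`, … recover the printed formulas), and the
  printed assertions about them are theorems: the additive symmetries "fix the cusp at infinity"
  (`addSymm_smul_infty`, `addSymmRefl_smul_infty`); the multiplicative symmetries "act transitively on the
  entire boundary of the upper half-plane" (`mulSymm_transitive_boundary`) [and fix the interior point
  `i`: `mulSymm_smul_I`, `mulSymmRefl_smul_I`]; "the only 'coric' symmetries, i.e., symmetries common to
  both the additive and multiplicative symmetries …, are the symmetries `{±1}` [i.e., `z ↦ z, −z̄`]"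
  (`additiveSymmetries_inter_multiplicativeSymmetries`); the additive symmetry "is closely related to the
  coordinate … `q := e^{2πiz}`": `q(z+a) = e^{2πia}·q(z)`, `q(−z̄+a) = e^{2πia}·conj q(z)`, `q(z+1) = q(z)`
  (`qParam_addSymm_smul`, `qParam_addSymmRefl_smul`, `qParam_addSymm_one_smul`); the multiplicative
  symmetry "is closely related to the coordinate … `w := (z − i)/(z + i)`" identifying `ℍ` with the unit
  disc: `|w| < 1` on `ℍ`, `w(i) = 0`, and `w(mulSymm t • z) = e^{−2it}·w(z)` is a rotation of the disc about
  `w(i) = 0` (`norm_cayley_lt_one`, `cayley_I`, `cayley_mulSymm_smul`).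
  NOTED only (the dictionary prose of (iii)/Fig. 6.4, whose IUT column names other seats' objects): `q` ↔
  the theta function at `l`-torsion points (Rmk. 6.12.6 (ii)); the cusp `∞` ↔ the basepoint `V^±` of
  Def. 6.1 (v), prototype "cusp" ([NodNon] Intro); `w` ↔ elements of `F_mod` (Rmk. 6.12.6 (iii)); the
  boundary ↔ `𝔽_l^⋇ ↷ V^Bor = 𝔽_l^⋇ · V^{±un}` (Ex. 4.3 (i)), prototype "nodes of the mod `p` Hecke
  correspondence" ([IUTchII] Rmk. 4.11.4 (iii)(c)); coric `{±1}` ↔ `{±1}`; the two symmetries ↔ the "two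
  combinatorial dimensions" of [AbsTopIII] Rmk. 5.6.1 and the indigenous bundles of Rmks. 4.3.3, 5.1.4.

Design notes. The four families are genuine elements of `GL (Fin 2) ℝ` (determinants `1, −1, 1, −1`), so
"transformation of `ℍ`", "cusp at infinity", "boundary" are Mathlib's notions; "biholomorphic isomorphism
with the unit disc" is recorded only through the three `w`-identities. Everything here is classical and
PROVED; the claim-form tags say that the STATEMENTS transcribe sentences of [IUTchI], not that anything
disputed is used. Nothing here takes a side on [IUTchIII] Cor. 3.12.
-/

namespace Literature.IUT.HodgeTheaters

open UpperHalfPlane Matrix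
open scoped ComplexConjugate

namespace Rmk6123

/-- The additive symmetry `z ↦ z + a` (`a ∈ ℝ`) of the upper half-plane, as the element `(1 a; 0 1)`
of `GL₂(ℝ)` ([IUTchI] Rmk. 6.12.3 (iii), p. 176, first display; Fig. 6.4 row "Additive symmetry").
[claim: Mochizuki2012, status: disputed] -/
noncomputable def addSymm (a : ℝ) : GL (Fin 2) ℝ :=
  Matrix.GeneralLinearGroup.mkOfDetNeZero !![1, a; 0, 1] (by rw [Matrix.det_fin_two_of]; norm_num)

/-- The additive symmetry `z ↦ −z̄ + a` (`a ∈ ℝ`) of the upper half-plane, as the element `(−1 a; 0 1)`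
of `GL₂(ℝ)` (determinant `−1`: Mathlib's action composes the Möbius map with complex conjugation)
([IUTchI] Rmk. 6.12.3 (iii), p. 176, first display). [claim: Mochizuki2012, status: disputed] -/
noncomputable def addSymmRefl (a : ℝ) : GL (Fin 2) ℝ :=
  Matrix.GeneralLinearGroup.mkOfDetNeZero !![-1, a; 0, 1] (by rw [Matrix.det_fin_two_of]; norm_num)

/-- The "toral" multiplicative symmetry `z ↦ (z·cos t − sin t)/(z·sin t + cos t)` (`t ∈ ℝ`) of the
upper half-plane, as the rotation `(cos t, −sin t; sin t, cos t) ∈ GL₂(ℝ)` ([IUTchI] Rmk. 6.12.3 (iii),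
p. 176, second display; Fig. 6.4 row "Multiplicative symmetry"). [claim: Mochizuki2012, status: disputed] -/
noncomputable def mulSymm (t : ℝ) : GL (Fin 2) ℝ :=
  Matrix.GeneralLinearGroup.mkOfDetNeZero !![Real.cos t, -Real.sin t; Real.sin t, Real.cos t] (by
    rw [Matrix.det_fin_two_of]; nlinarith [Real.sin_sq_add_cos_sq t])

/-- The multiplicative symmetry `z ↦ (z̄·cos t + sin t)/(z̄·sin t − cos t)` (`t ∈ ℝ`) of the upper
half-plane, as the element `(cos t, sin t; sin t, −cos t) ∈ GL₂(ℝ)` of determinant `−1` ([IUTchI]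
Rmk. 6.12.3 (iii), p. 176, second display). [claim: Mochizuki2012, status: disputed] -/
noncomputable def mulSymmRefl (t : ℝ) : GL (Fin 2) ℝ :=
  Matrix.GeneralLinearGroup.mkOfDetNeZero !![Real.cos t, Real.sin t; Real.sin t, -Real.cos t] (by
    rw [Matrix.det_fin_two_of]; nlinarith [Real.sin_sq_add_cos_sq t])

/-- For an element of negative determinant Mathlib's action on `ℍ` is the conjugate Möbius map. [folklore] -/
private theorem coe_smul_of_det_neg {g : GL (Fin 2) ℝ} (hg : g.det.val < 0) (z : ℍ) :
    ((g • z : ℍ) : ℂ) = conj (num g z / denom g z) := by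
  rw [coe_smul, σ, if_neg (not_lt.mpr hg.le)]; rfl

/-- [IUTchI] Rmk. 6.12.3 (iii) p. 176, the printed formula: `addSymm a` acts on `ℍ` by `z ↦ z + a`.
[claim: Mochizuki2012, status: disputed] -/
theorem coe_addSymm_smul (a : ℝ) (z : ℍ) : ((addSymm a • z : ℍ) : ℂ) = (z : ℂ) + a := by
  rw [coe_smul_of_det_pos (by simp [addSymm, Matrix.GeneralLinearGroup.val_det_apply, Matrix.det_fin_two_of])]
  simp [num, denom, addSymm]

/-- [IUTchI] Rmk. 6.12.3 (iii) p. 176, the printed formula: `addSymmRefl a` acts on `ℍ` by `z ↦ −z̄ + a`.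
[claim: Mochizuki2012, status: disputed] -/
theorem coe_addSymmRefl_smul (a : ℝ) (z : ℍ) : ((addSymmRefl a • z : ℍ) : ℂ) = -conj (z : ℂ) + a := by
  rw [coe_smul_of_det_neg (by simp [addSymmRefl, Matrix.GeneralLinearGroup.val_det_apply, Matrix.det_fin_two_of])]
  simp [num, denom, addSymmRefl, map_add, map_neg]

/-- [IUTchI] Rmk. 6.12.3 (iii) p. 176, the printed formula: `mulSymm t` acts on `ℍ` by
`z ↦ (z·cos t − sin t)/(z·sin t + cos t)`. [claim: Mochizuki2012, status: disputed] -/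
theorem coe_mulSymm_smul (t : ℝ) (z : ℍ) :
    ((mulSymm t • z : ℍ) : ℂ) = ((z : ℂ) * Real.cos t - Real.sin t) / ((z : ℂ) * Real.sin t + Real.cos t) := by
  rw [coe_smul_of_det_pos (by
    simp [mulSymm, Matrix.GeneralLinearGroup.val_det_apply, Matrix.det_fin_two_of]
    nlinarith [Real.sin_sq_add_cos_sq t])]
  simp [num, denom, mulSymm]
  ring

/-- [IUTchI] Rmk. 6.12.3 (iii) p. 176, the printed formula: `mulSymmRefl t` acts on `ℍ` by
`z ↦ (z̄·cos t + sin t)/(z̄·sin t − cos t)`. [claim: Mochizuki2012, status: disputed] -/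
theorem coe_mulSymmRefl_smul (t : ℝ) (z : ℍ) :
    ((mulSymmRefl t • z : ℍ) : ℂ) =
      (conj (z : ℂ) * Real.cos t + Real.sin t) / (conj (z : ℂ) * Real.sin t - Real.cos t) := by
  rw [coe_smul_of_det_neg (by
    simp [mulSymmRefl, Matrix.GeneralLinearGroup.val_det_apply, Matrix.det_fin_two_of]
    nlinarith [Real.sin_sq_add_cos_sq t])]
  simp [-Complex.ofReal_cos, -Complex.ofReal_sin, num, denom, mulSymmRefl, map_div₀, Complex.conj_ofReal]
  ring

/-! #### "the above additive symmetries of the upper half-plane fix the cusp at infinity" (p. 176) -/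

/-- [IUTchI] Rmk. 6.12.3 (iii) p. 176: "the above additive symmetries of the upper half-plane fix the cusp
at infinity" — the translations, acting on the boundary `P¹(ℝ) = OnePoint ℝ`. [claim: Mochizuki2012, status: disputed] -/
theorem addSymm_smul_infty (a : ℝ) : addSymm a • (OnePoint.infty : OnePoint ℝ) = OnePoint.infty := by
  rw [OnePoint.smul_infty_eq_self_iff]; simp [addSymm]

/-- [IUTchI] Rmk. 6.12.3 (iii) p. 176: "… fix the cusp at infinity" — the reflected translations
`z ↦ −z̄ + a`, acting on the boundary `P¹(ℝ) = OnePoint ℝ`. [claim: Mochizuki2012, status: disputed] -/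
theorem addSymmRefl_smul_infty (a : ℝ) :
    addSymmRefl a • (OnePoint.infty : OnePoint ℝ) = OnePoint.infty := by
  rw [OnePoint.smul_infty_eq_self_iff]; simp [addSymmRefl]

/-! #### the multiplicative symmetries form a one-parameter group fixing the basepoint `i ∈ ℍ` -/

/-- `mulSymm 0 = 1`: the multiplicative symmetries form a one-parameter group. [claim: Mochizuki2012, status: disputed] -/
theorem mulSymm_zero : mulSymm 0 = 1 := by
  ext i j; fin_cases i <;> fin_cases j <;> simp [mulSymm]

/-- `mulSymm (s + t) = mulSymm s · mulSymm t` (addition formulas). [claim: Mochizuki2012, status: disputed] -/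
theorem mulSymm_add (s t : ℝ) : mulSymm (s + t) = mulSymm s * mulSymm t := by
  ext i j
  fin_cases i <;> fin_cases j <;>
    simp [mulSymm, Matrix.mul_apply, Fin.sum_univ_two, Real.cos_add, Real.sin_add] <;> ring

/-- `mulSymm (−t) = (mulSymm t)⁻¹`. [claim: Mochizuki2012, status: disputed] -/
theorem mulSymm_neg (t : ℝ) : mulSymm (-t) = (mulSymm t)⁻¹ := by
  rw [eq_inv_iff_mul_eq_one, ← mulSymm_add, neg_add_cancel, mulSymm_zero]

/-- `i·sin t + cos t ≠ 0` (it has absolute value `1`). [folklore] -/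
private theorem I_mul_sin_add_cos_ne_zero (t : ℝ) : Complex.I * (Real.sin t : ℂ) + Real.cos t ≠ 0 := by
  intro h0
  have h1 := congrArg Complex.re h0
  have h2 := congrArg Complex.im h0
  simp only [Complex.add_re, Complex.mul_re, Complex.I_re, Complex.ofReal_re, Complex.I_im,
    Complex.ofReal_im, Complex.add_im, Complex.mul_im, Complex.zero_re, Complex.zero_im, zero_mul,
    mul_zero, sub_zero, zero_add, one_mul, add_zero] at h1 h2
  nlinarith [Real.sin_sq_add_cos_sq t]

/-- The multiplicative ("toral") symmetries fix the interior basepoint `i ∈ ℍ` (the centre `w = 0` of the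
disc picture of [IUTchI] Rmk. 6.12.3 (iii) p. 176). [claim: Mochizuki2012, status: disputed] -/
theorem mulSymm_smul_I (t : ℝ) : mulSymm t • UpperHalfPlane.I = UpperHalfPlane.I := by
  ext1
  rw [coe_mulSymm_smul, coe_I]
  rw [div_eq_iff (I_mul_sin_add_cos_ne_zero t)]
  ring_nf; rw [Complex.I_sq]; ring

/-- The multiplicative symmetries of determinant `−1` also fix `i ∈ ℍ` ([IUTchI] Rmk. 6.12.3 (iii) p. 176).
[claim: Mochizuki2012, status: disputed] -/
theorem mulSymmRefl_smul_I (t : ℝ) : mulSymmRefl t • UpperHalfPlane.I = UpperHalfPlane.I := by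
  ext1
  rw [coe_mulSymmRefl_smul, coe_I, Complex.conj_I]
  have h : -Complex.I * (Real.sin t : ℂ) - Real.cos t ≠ 0 := by
    rw [neg_mul, ← neg_add', neg_ne_zero]; exact I_mul_sin_add_cos_ne_zero t
  rw [div_eq_iff h]
  ring_nf; rw [Complex.I_sq]; ring

/-! #### "the multiplicative symmetries of the upper half-plane recalled above act transitively on the
entire boundary of the upper half-plane" (p. 177) — the boundary `∂ℍ = ℝ ∪ {∞} = P¹(ℝ)` is Mathlib's
`OnePoint ℝ` with its `GL₂(ℝ)`-action -/

/-- On the boundary, `mulSymm t` moves the cusp `∞` to `cot t ∈ ℝ` whenever `sin t ≠ 0` ([IUTchI] Rmk. 6.12.3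
(iii) p. 177). [claim: Mochizuki2012, status: disputed] -/
theorem mulSymm_smul_infty (t : ℝ) (ht : Real.sin t ≠ 0) :
    mulSymm t • (OnePoint.infty : OnePoint ℝ) = ((Real.cos t / Real.sin t : ℝ) : OnePoint ℝ) := by
  rw [OnePoint.smul_infty_eq_ite, if_neg (by simpa [mulSymm] using ht)]
  simp [mulSymm]

/-- Every boundary point of `ℍ` is a `mulSymm t`-translate of the cusp `∞` (`t = π/2 − arctan k` for
`k ∈ ℝ`) ([IUTchI] Rmk. 6.12.3 (iii) p. 177). [claim: Mochizuki2012, status: disputed] -/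
theorem exists_mulSymm_smul_infty_eq (x : OnePoint ℝ) :
    ∃ t : ℝ, mulSymm t • (OnePoint.infty : OnePoint ℝ) = x := by
  induction x using OnePoint.rec with
  | infty => exact ⟨0, by rw [mulSymm_zero, one_smul]⟩
  | coe k =>
    refine ⟨Real.pi / 2 - Real.arctan k, ?_⟩
    have hs : Real.sin (Real.pi / 2 - Real.arctan k) ≠ 0 := by
      rw [Real.sin_pi_div_two_sub]; exact (Real.cos_arctan_pos k).ne'
    rw [mulSymm_smul_infty _ hs, Real.sin_pi_div_two_sub, Real.cos_pi_div_two_sub,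
      ← Real.tan_eq_sin_div_cos, Real.tan_arctan]

/-- [IUTchI] Rmk. 6.12.3 (iii) p. 177: "the multiplicative symmetries of the upper half-plane recalled
above act transitively on the entire boundary of the upper half-plane" — `∂ℍ = P¹(ℝ) = OnePoint ℝ`
with Mathlib's `GL₂(ℝ)`-action [Fig. 6.4: `↷ {entire boundary of ℍ}` vs. `𝔽_l^⋇ ↷ V^Bor`].
[claim: Mochizuki2012, status: disputed] -/
theorem mulSymm_transitive_boundary (x y : OnePoint ℝ) : ∃ t : ℝ, mulSymm t • x = y := by
  obtain ⟨tx, hx⟩ := exists_mulSymm_smul_infty_eq x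
  obtain ⟨ty, hy⟩ := exists_mulSymm_smul_infty_eq y
  refine ⟨ty + -tx, ?_⟩
  rw [mulSymm_add, mul_smul, mulSymm_neg, ← hx, inv_smul_smul, hy]

/-! #### "the only coric symmetries, i.e., symmetries common to both the additive and multiplicative
symmetries of the upper half-plane recalled above, are the symmetries `{±1}` [i.e., the symmetries
`z ↦ z, −z̄`]" (p. 177; Fig. 6.4, last row) -/

/-- `addSymm 0 = 1`. [claim: Mochizuki2012, status: disputed] -/
theorem addSymm_zero : addSymm 0 = 1 := by
  ext i j; fin_cases i <;> fin_cases j <;> simp [addSymm]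

/-- `(−1 0; 0 1) = −(1 0; 0 −1)`: the reflection `z ↦ −z̄` belongs to both families (scalars act trivially
on `ℍ`). [claim: Mochizuki2012, status: disputed] -/
theorem addSymmRefl_zero_eq_neg_mulSymmRefl_zero : addSymmRefl 0 = -mulSymmRefl 0 := by
  ext i j; fin_cases i <;> fin_cases j <;> simp [addSymmRefl, mulSymmRefl]

/-- The set of "additive symmetries of the upper half-plane" of [IUTchI] Rmk. 6.12.3 (iii) p. 176 / Fig. 6.4:
the self-maps `z ↦ z + a`, `z ↦ −z̄ + a` (`a ∈ ℝ`) of `ℍ`. [claim: Mochizuki2012, status: disputed] -/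
def additiveSymmetries : Set (ℍ → ℍ) :=
  {f | ∃ a : ℝ, f = (fun z => addSymm a • z) ∨ f = (fun z => addSymmRefl a • z)}

/-- The set of "multiplicative symmetries of the upper half-plane" of [IUTchI] Rmk. 6.12.3 (iii) p. 176 /
Fig. 6.4: the self-maps `mulSymm t • ·`, `mulSymmRefl t • ·` (`t ∈ ℝ`) of `ℍ`. [claim: Mochizuki2012, status: disputed] -/
def multiplicativeSymmetries : Set (ℍ → ℍ) :=
  {f | ∃ t : ℝ, f = (fun z => mulSymm t • z) ∨ f = (fun z => mulSymmRefl t • z)}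

/-- The symmetry `z ↦ −z̄` of `ℍ` (the non-trivial "coric" symmetry "`−1`" of [IUTchI] Rmk. 6.12.3 (iii)
p. 177, Fig. 6.4 last row). [claim: Mochizuki2012, status: disputed] -/
noncomputable def reflection : ℍ → ℍ := fun z => addSymmRefl 0 • z

/-- `reflection z = −z̄`. [claim: Mochizuki2012, status: disputed] -/
theorem coe_reflection (z : ℍ) : ((reflection z : ℍ) : ℂ) = -conj (z : ℂ) := by
  simp [reflection, coe_addSymmRefl_smul]

/-- The reflection `z ↦ −z̄` is also the multiplicative symmetry `mulSymmRefl 0`. [claim: Mochizuki2012, status: disputed] -/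
theorem reflection_eq_mulSymmRefl_zero : reflection = fun z => mulSymmRefl 0 • z := by
  funext z
  rw [reflection, addSymmRefl_zero_eq_neg_mulSymmRefl_zero, UpperHalfPlane.neg_smul]

/-- If `i + a = i` in `ℂ` for a real `a`, then `a = 0`. [folklore] -/
private theorem eq_zero_of_I_add {a : ℝ} (h : (UpperHalfPlane.I : ℂ) + a = UpperHalfPlane.I) : a = 0 := by
  have := congrArg Complex.re h
  simpa [coe_I] using this

/-- [IUTchI] Rmk. 6.12.3 (iii) p. 177 (Fig. 6.4, row "Coric symmetries"): "the only 'coric' symmetries,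
i.e., symmetries common to both the additive and multiplicative symmetries of the upper half-plane
recalled above, are the symmetries '`{±1}`' [i.e., the symmetries `z ↦ z, −z̄` in the case of the upper
half-plane]" — PROVED: the two families of self-maps of `ℍ` meet exactly in `{id, z ↦ −z̄}` (the
multiplicative ones fix `i`, which forces the translation part of a common member to vanish).
[claim: Mochizuki2012, status: disputed] -/
theorem additiveSymmetries_inter_multiplicativeSymmetries :
    additiveSymmetries ∩ multiplicativeSymmetries = {id, reflection} := by
  ext f
  simp only [Set.mem_inter_iff, additiveSymmetries, multiplicativeSymmetries, Set.mem_setOf_eq,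
    Set.mem_insert_iff, Set.mem_singleton_iff]
  constructor
  · rintro ⟨⟨a, ha⟩, ⟨t, ht⟩⟩
    -- evaluate both descriptions of `f` at the basepoint `i`, which the multiplicative ones fix
    have hfix : f UpperHalfPlane.I = UpperHalfPlane.I := by
      rcases ht with rfl | rfl
      · exact mulSymm_smul_I t
      · exact mulSymmRefl_smul_I t
    rcases ha with rfl | rfl
    · have hI := congrArg UpperHalfPlane.coe hfix
      rw [coe_addSymm_smul] at hI
      have ha0 := eq_zero_of_I_add hI
      subst ha0
      left; funext z; rw [addSymm_zero, one_smul]; rfl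
    · have hI := congrArg UpperHalfPlane.coe hfix
      rw [coe_addSymmRefl_smul, coe_I, Complex.conj_I, neg_neg, ← coe_I] at hI
      have ha0 := eq_zero_of_I_add hI
      subst ha0
      right; rfl
  · rintro (rfl | rfl)
    · exact ⟨⟨0, Or.inl (by funext z; rw [addSymm_zero, one_smul]; rfl)⟩,
        ⟨0, Or.inl (by funext z; rw [mulSymm_zero, one_smul]; rfl)⟩⟩
    · exact ⟨⟨0, Or.inr rfl⟩, ⟨0, Or.inr reflection_eq_mulSymmRefl_zero⟩⟩

/-! #### "the above additive symmetry of the upper half-plane is closely related to the coordinate on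
the upper half-plane determined by the classical `q`-parameter `q := e^{2πiz}`" (p. 176) -/

/-- [IUTchI] Rmk. 6.12.3 (iii) p. 176: "the above additive symmetry of the upper half-plane is closely
related to the coordinate on the upper half-plane determined by the 'classical `q`-parameter'
`q := e^{2πiz}`" — PROVED form: `q(z + a) = e^{2πia} · q(z)` (Mathlib `Function.Periodic.qParam 1`).
[claim: Mochizuki2012, status: disputed] -/
theorem qParam_addSymm_smul (a : ℝ) (z : ℍ) :
    Function.Periodic.qParam 1 ((addSymm a • z : ℍ) : ℂ) =
      Complex.exp (2 * Real.pi * Complex.I * a) * Function.Periodic.qParam 1 z := by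
  simp only [Function.Periodic.qParam, coe_addSymm_smul, Complex.ofReal_one, div_one]
  rw [← Complex.exp_add]; ring_nf

/-- … in particular `q = e^{2πiz}` is invariant under the additive symmetry `z ↦ z + 1` ([IUTchI] Rmk. 6.12.3
(iii) p. 176). [claim: Mochizuki2012, status: disputed] -/
theorem qParam_addSymm_one_smul (z : ℍ) :
    Function.Periodic.qParam 1 ((addSymm 1 • z : ℍ) : ℂ) = Function.Periodic.qParam 1 z := by
  rw [qParam_addSymm_smul, Complex.ofReal_one, mul_one, Complex.exp_two_pi_mul_I, one_mul]

/-- … and `q(−z̄ + a) = e^{2πia} · conj q(z)` for the reflected translations ([IUTchI] Rmk. 6.12.3 (iii)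
p. 176). [claim: Mochizuki2012, status: disputed] -/
theorem qParam_addSymmRefl_smul (a : ℝ) (z : ℍ) :
    Function.Periodic.qParam 1 ((addSymmRefl a • z : ℍ) : ℂ) =
      Complex.exp (2 * Real.pi * Complex.I * a) * conj (Function.Periodic.qParam 1 z) := by
  simp only [Function.Periodic.qParam, coe_addSymmRefl_smul, Complex.ofReal_one, div_one]
  rw [← Complex.exp_conj, ← Complex.exp_add]
  congr 1
  simp only [map_mul, Complex.conj_ofReal, Complex.conj_I, map_ofNat]
  ring

/-! #### "the 'toral' multiplicative symmetry of the upper half-plane recalled above is closely related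
to the coordinate on the upper half-plane that determines a biholomorphic isomorphism with the unit
disc `w := (z − i)/(z + i)`" (p. 176) -/

/-- The coordinate `w := (z − i)/(z + i)` of [IUTchI] Rmk. 6.12.3 (iii) p. 176 ("determines a
biholomorphic isomorphism with the unit disc"; Fig. 6.4 row "'Functions' assoc'd to mult. symm.").
[claim: Mochizuki2012, status: disputed] -/
noncomputable def cayley (z : ℂ) : ℂ := (z - Complex.I) / (z + Complex.I)

/-- `z + i ≠ 0` for `z ∈ ℍ` (the denominator of `w`). [claim: Mochizuki2012, status: disputed] -/
theorem coe_add_I_ne_zero (z : ℍ) : (z : ℂ) + Complex.I ≠ 0 := by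
  intro h
  have := congrArg Complex.im h
  simp at this
  linarith [z.im_pos]

/-- `w(i) = 0`: the basepoint `i` fixed by the multiplicative symmetries is the centre of the disc
([IUTchI] Rmk. 6.12.3 (iii) p. 176). [claim: Mochizuki2012, status: disputed] -/
theorem cayley_I : cayley (UpperHalfPlane.I : ℂ) = 0 := by
  simp [cayley, coe_I]

/-- `|z − i|² < |z + i|²` on `ℍ` (their difference is `4·Im z`). [claim: Mochizuki2012, status: disputed] -/
theorem normSq_sub_I_lt_normSq_add_I (z : ℍ) :
    Complex.normSq ((z : ℂ) - Complex.I) < Complex.normSq ((z : ℂ) + Complex.I) := by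
  have hz := z.im_pos
  rw [← sub_pos]
  have : Complex.normSq ((z : ℂ) + Complex.I) - Complex.normSq ((z : ℂ) - Complex.I) = 4 * z.im := by
    simp [Complex.normSq_apply]; ring
  rw [this]; positivity

/-- [IUTchI] Rmk. 6.12.3 (iii) p. 176: `w = (z − i)/(z + i)` maps the upper half-plane INTO the unit disc,
`|w| < 1` (the part of "biholomorphic isomorphism with the unit disc" recorded here). [claim: Mochizuki2012, status: disputed] -/
theorem norm_cayley_lt_one (z : ℍ) : ‖cayley (z : ℂ)‖ < 1 := by
  rw [cayley, norm_div, div_lt_one (norm_pos_iff.mpr (coe_add_I_ne_zero z))]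
  have h := normSq_sub_I_lt_normSq_add_I z
  rw [Complex.normSq_eq_norm_sq, Complex.normSq_eq_norm_sq] at h
  exact lt_of_pow_lt_pow_left₀ 2 (norm_nonneg _) h

/-- The coordinate `w` of a fraction: `w(N/D) = (N − D·i)/(N + i·D)` for `D ≠ 0`. [folklore] -/
private theorem cayley_div_eq {N D : ℂ} (hD : D ≠ 0) :
    cayley (N / D) = (N - D * Complex.I) / (N + Complex.I * D) := by
  unfold cayley
  rw [div_sub' hD, div_add' _ _ _ hD, div_div_div_cancel_right₀ hD]

/-- [IUTchI] Rmk. 6.12.3 (iii) p. 176: "the 'toral' multiplicative symmetry … is closely related to the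
coordinate … `w`" — PROVED form: in the coordinate `w` the symmetry `mulSymm t` is the ROTATION
`w ↦ (cos t − i sin t)/(cos t + i sin t) · w = e^{−2it} · w` of the disc about `w(i) = 0`. [claim: Mochizuki2012, status: disputed] -/
theorem cayley_mulSymm_smul (t : ℝ) (z : ℍ) :
    cayley ((mulSymm t • z : ℍ) : ℂ) =
      (Real.cos t - Real.sin t * Complex.I) / (Real.cos t + Real.sin t * Complex.I) * cayley z := by
  have h1 : (z : ℂ) * Real.sin t + Real.cos t ≠ 0 := by
    simpa [-Complex.ofReal_cos, -Complex.ofReal_sin, denom, mulSymm, mul_comm] using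
      denom_ne_zero (mulSymm t) z
  have hnum : (z : ℂ) * Real.cos t - Real.sin t - ((z : ℂ) * Real.sin t + Real.cos t) * Complex.I
      = ((Real.cos t : ℂ) - Real.sin t * Complex.I) * ((z : ℂ) - Complex.I) := by
    ring_nf; rw [Complex.I_sq]; ring
  have hden : (z : ℂ) * Real.cos t - Real.sin t + Complex.I * ((z : ℂ) * Real.sin t + Real.cos t)
      = ((Real.cos t : ℂ) + Real.sin t * Complex.I) * ((z : ℂ) + Complex.I) := by
    ring_nf; rw [Complex.I_sq]; ring
  rw [coe_mulSymm_smul, cayley_div_eq h1, hnum, hden, mul_div_mul_comm, cayley]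

end Rmk6123

end Literature.IUT.HodgeTheaters
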